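import Literature.Geometry.Lorentzian.SpacetimeLocalConvergence
import Literature.Geometry.Lorentzian.LorentzianMetricProofs
import Literature.Geometry.Manifold.OpenSubmanifoldMFDeriv
import HarnessLib

/-!
# Pointed `Cᵏ_loc` subconvergence is stable under shrinking the limit

Companion to `Literature.Geometry.Lorentzian.SpacetimeLocalConvergence` (pointed Cheeger–Gromov
subconvergence of spacetimes, `Spacetime.LocalSubconvergence` / `Spacetime.SubconvergesLocallyTo`).
That notion carries, by design, NO covering clause (module docstring there: "the limit is
asserted to capture what the embeddings see … statements that need more say so themselves").
This file records the resulting monotonicity in the limit, which every consumer of the notion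
must keep in mind:

* `Spacetime.LocalSubconvergence.restrict` — if `(𝓢ₙ n, pₙ n) ⇀ (𝓢, p)` in `Cᵏ` and `W` is a
  connected open subset of the limit containing `p`, then `(𝓢ₙ n, pₙ n) ⇀ (𝓢|_W, p)`: the open
  sub-spacetime `𝓢.restrict … W` (restricted metric and time orientation,
  `LorentzianMetric.lean`) is again a limit, along a further subsequence, with the SAME comparison
  maps composed with the inclusion `W ↪ 𝓢`;
* `Spacetime.SubconvergesLocallyTo.restrict` — the `Prop` form (`restrict'`: the same with the
  smoothness-of-restriction hypotheses of `Spacetime.restrict` discharged).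

In Petersen's formulation (pointed convergence: for every `R` a domain `Ω ⊇ B(p, R)` of the limit
and embeddings `Fᵢ : Ω → Mᵢ` with `Fᵢ^* gᵢ → g` on `Ω`; *Riemannian Geometry*, 2nd ed., Ch. 10,
§3.2) this is the remark that convergence on the domains `Ω` entails convergence on every smaller
domain; WITH Petersen's covering clause `Fᵢ(Ω) ⊇ B(pᵢ, R)` the limit is unique up to isometry and
cannot be shrunk, WITHOUT it (the tree's choice) every connected open neighbourhood of the base
point of a limit is again a limit. Consequence for users (e.g. hull / ω-limit constructions over
`SubconvergesLocallyTo`): a "limit object" is only determined up to passing to open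
neighbourhoods of the base point unless the statement adds its own covering or maximality clause.

## Proof

Exhaust `W` by the precompact open sets of `LocalSubconvergence.refl (𝓢|_W)`; the closure of the
`m`-th one is compact in `W`, so its image is a compact subset of the limit and lies in the
`n`-th exhausting set `U n` of the given datum for all large `n` (`eventually_subset_U`); choose
such indices strictly increasingly (`restrictIndex`) and compose the comparison maps with the
inclusion. The inclusion of an open sub-spacetime is an injective local diffeomorphism with
identity differential (`OpenSubmanifold.mfderiv_subtype_val`), the restricted time orientation
is the restricted vector field, and in the preferred charts — the chart of `W` at `x` is the
restricted chart of `𝓢` at `↑x` (`TopologicalSpace.Opens.chartAt_eq`), whose inverse is the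
inverse chart of `𝓢` followed by the inclusion ON ITS WHOLE TARGET
(`OpenPartialHomeomorph.subtypeRestr_symm_eqOn`) — the coordinate components of the metrics
agree on the (open) chart target, so the `Cᵏ` sup norms over compact subsets of the target are
literally the ones of the given datum (`supCkENorm` only sees germs at points of the set).

## References

* [Petersen2006] P. Petersen, *Riemannian Geometry*, 2nd ed., GTM 171, Springer 2006, Ch. 10,
  §3.2 (pointed `C^{m,α}` convergence of Riemannian manifolds).
* [Anderson2004] M. T. Anderson, *Cheeger–Gromov theory and applications to general
  relativity*, in: The Einstein equations and the large scale behavior of gravitational fields,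
  Birkhäuser 2004, 347–377 (arXiv:gr-qc/0208079), Def. 1.1.
* [ONeill1983] B. O'Neill, *Semi-Riemannian Geometry*, Academic Press 1983, Ch. 3, p. 57 (open
  submanifolds).
-/

noncomputable section

open TopologicalSpace Manifold Filter Topology Set Function
open scoped ContDiff Topology ENNReal

universe u v

namespace Literature.Geometry.Lorentzian

namespace Spacetime

/-! ### Coordinate components of the metric only see germs of the parametrisation -/

section Congr

variable (𝓣 : Spacetime.{u} 4)

/-- The components `metricInCoords 𝓣 ψ y` depend only on the value and the differential of
`ψ` at `y` (cross-point form: the two base points `ψ₁ y`, `ψ₂ y` are identified along the given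
equality; all tangent spaces are the model space `E4`). [folklore] -/
theorem metricInCoords_congr_of_eq {ψ₁ ψ₂ : E4 → 𝓣.carrier} {y : E4} (h0 : ψ₁ y = ψ₂ y)
    (h1 : (mfderiv 𝓘(ℝ, E4) (𝓡 4) ψ₁ y : E4 →L[ℝ] E4) = mfderiv 𝓘(ℝ, E4) (𝓡 4) ψ₂ y) :
    𝓣.metricInCoords ψ₁ y = 𝓣.metricInCoords ψ₂ y := by
  ext v w
  rw [metricInCoords_apply, metricInCoords_apply]
  have key : ∀ (a b : 𝓣.carrier), a = b → ∀ (S T : E4 →L[ℝ] E4), S = T →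
      𝓣.metric.val a (S v) (S w) = 𝓣.metric.val b (T v) (T w) := by
    rintro a b rfl S T rfl
    rfl
  exact key _ _ h0 _ _ h1

/-- The components `metricInCoords 𝓣 ψ y` depend only on the germ of `ψ` at `y`. [folklore] -/
theorem metricInCoords_congr_of_eventuallyEq {ψ₁ ψ₂ : E4 → 𝓣.carrier} {y : E4}
    (h : ψ₁ =ᶠ[𝓝 y] ψ₂) : 𝓣.metricInCoords ψ₁ y = 𝓣.metricInCoords ψ₂ y :=
  𝓣.metricInCoords_congr_of_eq h.eq_of_nhds h.mfderiv_eq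

end Congr

/-! ### The open sub-spacetime `𝓢|_W`: inclusion, charts, metric components -/

section Restrict

variable (𝓢 : Spacetime.{v} 4)
  (hres : PseudoRiemannianMetric.contMDiff_restrict (I := 𝓡 4) (n := ∞) (M := 𝓢.carrier))
  (hτ : 𝓢.timeOrientation.contMDiff_restrict)
  (W : Opens 𝓢.carrier) (hW : IsConnected (W : Set 𝓢.carrier))

/-- The inclusion `W ↪ 𝓢` of an open sub-spacetime is a `C^∞` local diffeomorphism at every
point (the coercion partial homeomorphism `W ⇀ 𝓢` is a partial diffeomorphism: it reads as the
identity in the restricted charts). O'Neill 1983, Ch. 3, p. 57. [folklore] -/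
theorem isLocalDiffeomorphAt_subtypeVal_restrict (x : (𝓢.restrict hres hτ W hW).carrier) :
    IsLocalDiffeomorphAt (𝓡 4) (𝓡 4) ∞
      (Subtype.val : (𝓢.restrict hres hτ W hW).carrier → 𝓢.carrier) x := by
  have hne : Nonempty W := ⟨x⟩
  set c := W.openPartialHomeomorphSubtypeCoe hne with hc
  have h1 : ContMDiffOn (𝓡 4) (𝓡 4) ∞ c c.source := by
    rw [hc, TopologicalSpace.Opens.openPartialHomeomorphSubtypeCoe_source]
    exact (contMDiff_subtype_val.contMDiffOn (s := univ)).congr fun z _ ↦ by simp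
  have h2 : ContMDiffOn (𝓡 4) (𝓡 4) ∞ c.symm c.target := by
    have key : EqOn (Subtype.val ∘ c.symm) id c.target := fun w hw ↦ c.right_inv hw
    intro z hz
    have h3 : ContMDiffWithinAt (𝓡 4) (𝓡 4) ∞ (Subtype.val ∘ c.symm) c.target z :=
      contMDiffWithinAt_id.congr key (key hz)
    exact (ContMDiffWithinAt.subtypeVal_comp_iff W _ _ _).1 h3
  let Φ : PartialDiffeomorph (𝓡 4) (𝓡 4) (𝓢.restrict hres hτ W hW).carrier 𝓢.carrier ∞ :=
    { toPartialEquiv := c.toPartialEquiv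
      open_source := c.open_source
      open_target := c.open_target
      contMDiffOn_toFun := h1
      contMDiffOn_invFun := h2 }
  refine ⟨Φ, ?_, fun q _ ↦ ?_⟩
  · show x ∈ c.source
    rw [hc, TopologicalSpace.Opens.openPartialHomeomorphSubtypeCoe_source]
    exact mem_univ _
  · show Subtype.val q = c q
    rw [hc, TopologicalSpace.Opens.openPartialHomeomorphSubtypeCoe_coe]

/-- The preferred chart of the open sub-spacetime at `x` is the restricted chart of `𝓢` at `↑x`
(`TopologicalSpace.Opens.chartAt_eq`, through the `Spacetime.restrict` packaging). [folklore] -/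
theorem chartAt_restrict (x : (𝓢.restrict hres hτ W hW).carrier) :
    chartAt E4 x = (chartAt E4 (Subtype.val x)).subtypeRestr ⟨x⟩ :=
  rfl

/-- The target of the restricted chart lies in the target of the chart of `𝓢`. [folklore] -/
theorem chartAt_restrict_target_subset (x : (𝓢.restrict hres hτ W hW).carrier) :
    (chartAt E4 x).target ⊆ (chartAt E4 (Subtype.val x)).target := by
  rw [chartAt_restrict]
  exact (chartAt E4 (Subtype.val x)).subtypeRestr_target_subset ⟨x⟩

/-- On the target of the restricted chart, the inverse chart of `𝓢` at `↑x` is the inclusion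
composed with the inverse restricted chart (`OpenPartialHomeomorph.subtypeRestr_symm_eqOn`).
[folklore] -/
theorem subtypeVal_comp_chartAt_restrict_symm_eqOn (x : (𝓢.restrict hres hτ W hW).carrier) :
    EqOn (Subtype.val ∘ (chartAt E4 x).symm) (chartAt E4 (Subtype.val x)).symm
      (chartAt E4 x).target := by
  rw [chartAt_restrict]
  exact ((chartAt E4 (Subtype.val x)).subtypeRestr_symm_eqOn ⟨x⟩).symm

/-- Germ form of the previous lemma at a point of the (open) target. [folklore] -/
theorem subtypeVal_comp_chartAt_restrict_symm_eventuallyEq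
    (x : (𝓢.restrict hres hτ W hW).carrier) {y : E4} (hy : y ∈ (chartAt E4 x).target) :
    (Subtype.val ∘ (chartAt E4 x).symm) =ᶠ[𝓝 y] (chartAt E4 (Subtype.val x)).symm :=
  Filter.eventuallyEq_of_mem ((chartAt E4 x).open_target.mem_nhds hy)
    (𝓢.subtypeVal_comp_chartAt_restrict_symm_eqOn hres hτ W hW x)

/-- **The metric components of `𝓢|_W` in its preferred charts are those of `𝓢`**: on the
target of the restricted chart at `x`,
`metricInCoords (𝓢|_W) (chartAt x)⁻¹ = metricInCoords 𝓢 (chartAt ↑x)⁻¹` (the restricted metric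
at `z` is the metric at `↑z`, the inclusion has identity differential, and the inverse charts
agree there). O'Neill 1983, Ch. 3, p. 57. [folklore] -/
theorem metricInCoords_restrict_chartAt_symm (x : (𝓢.restrict hres hτ W hW).carrier) {y : E4}
    (hy : y ∈ (chartAt E4 x).target) :
    (𝓢.restrict hres hτ W hW).metricInCoords (chartAt E4 x).symm y =
      𝓢.metricInCoords (chartAt E4 (Subtype.val x)).symm y := by
  set cW := chartAt E4 x with hcW
  have hdiffW : MDifferentiableAt 𝓘(ℝ, E4) (𝓡 4) cW.symm y :=
    mdifferentiableAt_atlas_symm (chart_mem_atlas E4 x) hy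
  -- differential of `val ∘ cW⁻¹` : identity after `d(cW⁻¹)`, and equal to `d((chartAt ↑x)⁻¹)`
  have hcomp : (mfderiv 𝓘(ℝ, E4) (𝓡 4) (Subtype.val ∘ cW.symm) y : E4 →L[ℝ] E4) =
      mfderiv 𝓘(ℝ, E4) (𝓡 4) cW.symm y := by
    rw [mfderiv_comp y (Literature.Geometry.Manifold.OpenSubmanifold.mdifferentiableAt_subtype_val _)
      hdiffW, Literature.Geometry.Manifold.OpenSubmanifold.mfderiv_subtype_val]
    exact ContinuousLinearMap.id_comp _
  have heq := 𝓢.subtypeVal_comp_chartAt_restrict_symm_eventuallyEq hres hτ W hW x hy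
  have h0 : Subtype.val (cW.symm y) =
      (chartAt E4 (Subtype.val x)).symm y := heq.eq_of_nhds
  have h1 : (mfderiv 𝓘(ℝ, E4) (𝓡 4) cW.symm y : E4 →L[ℝ] E4) =
      mfderiv 𝓘(ℝ, E4) (𝓡 4) (chartAt E4 (Subtype.val x)).symm y := by
    rw [← hcomp]
    exact heq.mfderiv_eq
  ext v w
  rw [metricInCoords_apply, metricInCoords_apply]
  have key : ∀ (a : (𝓢.restrict hres hτ W hW).carrier) (b : 𝓢.carrier), Subtype.val a = b →
      ∀ (S T : E4 →L[ℝ] E4), S = T →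
        (𝓢.restrict hres hτ W hW).metric.val a (S v) (S w) = 𝓢.metric.val b (T v) (T w) := by
    rintro a b rfl S T rfl
    rfl
  exact key _ _ h0 _ _ h1

/-- **Chain rule through the inclusion of the open sub-spacetime** (`dι = id`): the
differential of `f ∘ ι` at `x ∈ W` is the differential of `f` at `↑x`. [folklore] -/
theorem mfderiv_comp_subtypeVal_restrict {N : Type*} [TopologicalSpace N] [ChartedSpace E4 N]
    (f : 𝓢.carrier → N) (x : (𝓢.restrict hres hτ W hW).carrier)
    (hf : MDifferentiableAt (𝓡 4) (𝓡 4) f (Subtype.val x)) :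
    mfderiv (𝓡 4) (𝓡 4) (f ∘ Subtype.val : (𝓢.restrict hres hτ W hW).carrier → N) x =
      mfderiv (𝓡 4) (𝓡 4) f (Subtype.val x) := by
  have h := mfderiv_comp x hf
    (Literature.Geometry.Manifold.OpenSubmanifold.mdifferentiableAt_subtype_val (I := 𝓡 4)
      (U := W) x)
  have h3 : (mfderiv (𝓡 4) (𝓡 4) f (Subtype.val x)).comp
      (mfderiv (𝓡 4) (𝓡 4) (Subtype.val : W → 𝓢.carrier) x) =
        mfderiv (𝓡 4) (𝓡 4) f (Subtype.val x) := by
    rw [Literature.Geometry.Manifold.OpenSubmanifold.mfderiv_subtype_val]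
    exact ContinuousLinearMap.comp_id _
  exact h.trans h3

/-- **Time orientations through the inclusion.** If `dE` at `↑x` sends the orienting vector of
`𝓢` to a future-directed vector of `𝓣`, then `d(E ∘ ι)` at `x` sends the orienting vector of
`𝓢|_W` (the restricted vector field) to the same future-directed vector. [folklore] -/
theorem isFutureDirected_mfderiv_comp_subtypeVal_restrict {𝓣 : Spacetime.{u} 4}
    (E : 𝓢.carrier → 𝓣.carrier) (x : (𝓢.restrict hres hτ W hW).carrier)
    (hE : MDifferentiableAt (𝓡 4) (𝓡 4) E (Subtype.val x))
    (h : 𝓣.timeOrientation.IsFutureDirected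
      (mfderiv (𝓡 4) (𝓡 4) E (Subtype.val x) (𝓢.timeOrientation.vectorField (Subtype.val x)))) :
    𝓣.timeOrientation.IsFutureDirected
      (mfderiv (𝓡 4) (𝓡 4) (E ∘ Subtype.val : (𝓢.restrict hres hτ W hW).carrier → 𝓣.carrier) x
        ((𝓢.restrict hres hτ W hW).timeOrientation.vectorField x)) := by
  rw [𝓢.mfderiv_comp_subtypeVal_restrict hres hτ W hW E x hE]
  exact h

end Restrict

/-! ### Restricting a subconvergence datum to an open sub-spacetime of the limit -/

namespace LocalSubconvergence

variable {𝓢ₙ : ℕ → Spacetime.{u} 4} {pₙ : ∀ n, (𝓢ₙ n).carrier} {𝓢 : Spacetime.{v} 4}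
  {p : 𝓢.carrier} {k : ℕ}

section Restrict

variable (D : LocalSubconvergence 𝓢ₙ pₙ 𝓢 p k)
  (hres : PseudoRiemannianMetric.contMDiff_restrict (I := 𝓡 4) (n := ∞) (M := 𝓢.carrier))
  (hτ : 𝓢.timeOrientation.contMDiff_restrict)
  (W : Opens 𝓢.carrier) (hW : IsConnected (W : Set 𝓢.carrier))

/-- The exhausting open sets of the restricted datum: the precompact open exhaustion of the
sub-spacetime `𝓢|_W` used by `LocalSubconvergence.refl` (base point `⟨p, hp⟩`, order `k`).
[folklore] -/
def restrictOpens (hp : p ∈ W) (k m : ℕ) : Opens (𝓢.restrict hres hτ W hW).carrier :=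
  (LocalSubconvergence.refl (𝓢.restrict hres hτ W hW) (Subtype.mk p hp) k).U m

/-- **Eventual containment.** The closure of the `m`-th exhausting set of `𝓢|_W` is compact, so
its image in the limit lies in `D.U n` for all large `n` (`eventually_subset_U`). Petersen 2006,
Ch. 10, §3.2. [folklore] -/
theorem exists_forall_image_closure_restrictOpens_subset (hp : p ∈ W) (m : ℕ) :
    ∃ N, ∀ n ≥ N, Subtype.val '' closure (restrictOpens hres hτ W hW hp k m :
      Set (𝓢.restrict hres hτ W hW).carrier) ⊆ D.U n :=
  eventually_atTop.1 (D.eventually_subset_U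
    (((LocalSubconvergence.refl (𝓢.restrict hres hτ W hW) (Subtype.mk p hp) k).isCompact_closure_U
      m).image continuous_subtype_val))

/-- **The reindexing `ρ`** of the restricted datum: strictly increasing, with
`val '' closure (restrictOpens m) ⊆ D.U (ρ m)` (a threshold index for each `m`, made strictly
increasing recursively). [folklore] -/
def restrictIndex (hp : p ∈ W) : ℕ → ℕ
  | 0 => (D.exists_forall_image_closure_restrictOpens_subset hres hτ W hW hp 0).choose
  | m + 1 => max (D.exists_forall_image_closure_restrictOpens_subset hres hτ W hW hp (m + 1)).choose
      (restrictIndex hp m + 1)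

/-- The threshold index is below `ρ m`. [folklore] -/
theorem choose_le_restrictIndex (hp : p ∈ W) (m : ℕ) :
    (D.exists_forall_image_closure_restrictOpens_subset hres hτ W hW hp m).choose ≤
      D.restrictIndex hres hτ W hW hp m := by
  cases m with
  | zero => exact le_rfl
  | succ m => exact le_max_left _ _

/-- `ρ` is strictly increasing. [folklore] -/
theorem strictMono_restrictIndex (hp : p ∈ W) : StrictMono (D.restrictIndex hres hτ W hW hp) :=
  strictMono_nat_of_lt_succ fun m ↦
    (Nat.lt_succ_self _).trans_le (le_max_right _ (D.restrictIndex hres hτ W hW hp m + 1))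

/-- The image of the closure of the `m`-th exhausting set of `𝓢|_W` lies in `D.U (ρ m)`.
[folklore] -/
theorem image_closure_restrictOpens_subset (hp : p ∈ W) (m : ℕ) :
    Subtype.val '' closure (restrictOpens hres hτ W hW hp k m : Set (𝓢.restrict hres hτ W hW).carrier)
      ⊆ D.U (D.restrictIndex hres hτ W hW hp m) :=
  (D.exists_forall_image_closure_restrictOpens_subset hres hτ W hW hp m).choose_spec _
    (D.choose_le_restrictIndex hres hτ W hW hp m)

/-- A point of the `m`-th exhausting set of `𝓢|_W` lies, as a point of `𝓢`, in `D.U (ρ m)`.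
[folklore] -/
theorem val_mem_U (hp : p ∈ W) {m : ℕ} {x : (𝓢.restrict hres hτ W hW).carrier}
    (hx : x ∈ restrictOpens hres hτ W hW hp k m) :
    Subtype.val x ∈ D.U (D.restrictIndex hres hτ W hW hp m) :=
  D.image_closure_restrictOpens_subset hres hτ W hW hp m ⟨x, subset_closure hx, rfl⟩

/-- **Restriction of a subconvergence datum to an open sub-spacetime of the limit.** If
`(𝓢ₙ n, pₙ n) ⇀ (𝓢, p)` in the pointed `Cᵏ` sense with datum `D` and `W ∋ p` is a connected open
subset of the limit, then `(𝓢ₙ n, pₙ n) ⇀ (𝓢|_W, ⟨p, hp⟩)`: along the further subsequence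
`D.sub ∘ ρ`, with the exhaustion of `W` by precompact open sets and the comparison maps
`D.embed (ρ m) ∘ ι` (`ι : W ↪ 𝓢` the inclusion). No covering clause is involved — this is
exactly the monotonicity in the limit that the absence of a covering clause permits (module
docstring). Petersen 2006, Ch. 10, §3.2. [cite: Petersen2006, Ch. 10 §3.2] -/
def restrict (hp : p ∈ W) :
    LocalSubconvergence 𝓢ₙ pₙ (𝓢.restrict hres hτ W hW) (Subtype.mk p hp) k where
  sub := D.sub ∘ D.restrictIndex hres hτ W hW hp
  strictMono_sub := D.strictMono_sub.comp (D.strictMono_restrictIndex hres hτ W hW hp)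
  U := restrictOpens hres hτ W hW hp k
  monotone_U := (LocalSubconvergence.refl (𝓢.restrict hres hτ W hW) (Subtype.mk p hp) k).monotone_U
  mem_U := (LocalSubconvergence.refl (𝓢.restrict hres hτ W hW) (Subtype.mk p hp) k).mem_U
  iUnion_U := (LocalSubconvergence.refl (𝓢.restrict hres hτ W hW) (Subtype.mk p hp) k).iUnion_U
  isCompact_closure_U :=
    (LocalSubconvergence.refl (𝓢.restrict hres hτ W hW) (Subtype.mk p hp) k).isCompact_closure_U
  embed m := D.embed (D.restrictIndex hres hτ W hW hp m) ∘ Subtype.val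
  isLocalDiffeomorphOn_embed m := by
    intro x
    exact IsLocalDiffeomorphAt.comp
      (hf := 𝓢.isLocalDiffeomorphAt_subtypeVal_restrict hres hτ W hW x.1)
      (hg := D.isLocalDiffeomorphOn_embed _ ⟨Subtype.val x.1, D.val_mem_U hres hτ W hW hp x.2⟩)
  injOn_embed m := (D.injOn_embed _).comp Subtype.val_injective.injOn
      fun _ hx ↦ D.val_mem_U hres hτ W hW hp hx
  embed_basepoint m := D.embed_basepoint _
  isFutureDirected_mfderiv_embed m x hx := by
    have hd : MDifferentiableAt (𝓡 4) (𝓡 4) (D.embed (D.restrictIndex hres hτ W hW hp m))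
        (Subtype.val x) :=
      ((D.contMDiffOn_embed _).contMDiffAt
        ((D.U _).isOpen.mem_nhds (D.val_mem_U hres hτ W hW hp hx))).mdifferentiableAt (by simp)
    exact 𝓢.isFutureDirected_mfderiv_comp_subtypeVal_restrict hres hτ W hW _ x hd
      (D.isFutureDirected_mfderiv_embed _ (Subtype.val x) (D.val_mem_U hres hτ W hW hp hx))
  tendsto_supCkENorm x K hK hKt := by
    have hKt' : K ⊆ (chartAt E4 (Subtype.val x)).target :=
      hKt.trans (𝓢.chartAt_restrict_target_subset hres hτ W hW x)
    have hlim : Tendsto (fun m ↦ supCkENorm K k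
        ((𝓢ₙ (D.sub (D.restrictIndex hres hτ W hW hp m))).metricInCoords
          (D.embed (D.restrictIndex hres hτ W hW hp m) ∘ (chartAt E4 (Subtype.val x)).symm) -
            𝓢.metricInCoords (chartAt E4 (Subtype.val x)).symm)) atTop (𝓝 0) :=
      (D.tendsto_supCkENorm (Subtype.val x) K hK hKt').comp
        (D.strictMono_restrictIndex hres hτ W hW hp).tendsto_atTop
    refine hlim.congr fun m ↦ ?_
    simp only [supCkENorm]
    refine iSup_congr fun i ↦ iSup_congr fun _ ↦ iSup_congr fun y ↦ iSup_congr fun hy ↦ ?_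
    refine congrArg (fun t ↦ ‖t‖ₑ) ((Filter.EventuallyEq.iteratedFDeriv ℝ ?_ i).eq_of_nhds)
    filter_upwards [(chartAt E4 x).open_target.mem_nhds (hKt hy)] with z hz
    rw [Pi.sub_apply, Pi.sub_apply, 𝓢.metricInCoords_restrict_chartAt_symm hres hτ W hW x hz]
    exact congrArg₂ (· - ·)
      ((𝓢ₙ (D.sub (D.restrictIndex hres hτ W hW hp m))).metricInCoords_congr_of_eventuallyEq
        ((𝓢.subtypeVal_comp_chartAt_restrict_symm_eventuallyEq hres hτ W hW x hz).fun_comp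
          (D.embed (D.restrictIndex hres hτ W hW hp m)))).symm rfl

end Restrict

end LocalSubconvergence

/-- **Pointed `Cᵏ_loc` subconvergence passes to connected open neighbourhoods of the base point
in the limit**: if `(𝓢ₙ n, pₙ n) ⇀ (𝓢, p)` and `W ∋ p` is a connected open subset of `𝓢`, then
`(𝓢ₙ n, pₙ n) ⇀ (𝓢|_W, ⟨p, hp⟩)`. (The tree's notion has no covering clause; with one, limits
could not be shrunk.) Petersen 2006, Ch. 10, §3.2. [cite: Petersen2006, Ch. 10 §3.2] -/
theorem SubconvergesLocallyTo.restrict {𝓢ₙ : ℕ → Spacetime.{u} 4} {pₙ : ∀ n, (𝓢ₙ n).carrier}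
    {𝓢 : Spacetime.{v} 4} {p : 𝓢.carrier} {k : ℕ} (h : SubconvergesLocallyTo 𝓢ₙ pₙ 𝓢 p k)
    (hres : PseudoRiemannianMetric.contMDiff_restrict (I := 𝓡 4) (n := ∞) (M := 𝓢.carrier))
    (hτ : 𝓢.timeOrientation.contMDiff_restrict)
    (W : Opens 𝓢.carrier) (hW : IsConnected (W : Set 𝓢.carrier)) (hp : p ∈ W) :
    SubconvergesLocallyTo 𝓢ₙ pₙ (𝓢.restrict hres hτ W hW) (Subtype.mk p hp) k :=
  h.elim fun D ↦ ⟨D.restrict hres hτ W hW hp⟩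

/-- The same, with the restriction hypotheses of `Spacetime.restrict` discharged
(`PseudoRiemannianMetric.contMDiff_restrict_holds`, `TimeOrientation.contMDiff_restrict_holds`).
[cite: Petersen2006, Ch. 10 §3.2] -/
theorem SubconvergesLocallyTo.restrict' {𝓢ₙ : ℕ → Spacetime.{u} 4}
    {pₙ : ∀ n, (𝓢ₙ n).carrier} {𝓢 : Spacetime.{v} 4} {p : 𝓢.carrier} {k : ℕ}
    (h : SubconvergesLocallyTo 𝓢ₙ pₙ 𝓢 p k)
    (W : Opens 𝓢.carrier) (hW : IsConnected (W : Set 𝓢.carrier)) (hp : p ∈ W) :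
    SubconvergesLocallyTo 𝓢ₙ pₙ
      (𝓢.restrict PseudoRiemannianMetric.contMDiff_restrict_holds
        𝓢.timeOrientation.contMDiff_restrict_holds W hW) (Subtype.mk p hp) k :=
  h.restrict _ _ W hW hp

end Spacetime

end Literature.Geometry.Lorentzian

end
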